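import Literature.AlgebraicGeometry.Frobenioids.CdIsFrobenioid
import Literature.AlgebraicGeometry.Frobenioids.SupportsRealActionFunctor
import HarnessLib

/-!
# Frobenioids I, Proposition 2.5 (iii) for `Λ = ℝ` (the printed generality "`d ∈ Λ_{>0}`, `Λ` supports `Φ`")

Mochizuki, *The geometry of Frobenioids I: the general theory*, Kyushu J. Math. **62** (2008)
293–400, §2, Proposition 2.5 (iii), p. 48 l. 39 – p. 49 l. 9 [cite: MochizukiFrdI2008, Prop. 2.5(iii) p.49]:
"Let `τ` be a characteristic splitting on `C`; `Λ` a monoid type that supports `Φ`; `d ∈ Λ_{>0}`.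
Suppose that the Frobenioid `C` is of Frobenius-normalized, metrically trivial, and Aut-ample type.
Then: … (iii) There exists an equivalence of categories `Ψ : C ⥲ C(d)` — … the unit-linear Frobenius
functor [associated to `τ`, `d`] — that satisfies …: (a) `Ψ` acts as the identity on objects and
isometries of `C`; (b) `Ψ` is 1-compatible, relative to the functors `C → F_Φ`, `C(d) → F_{d·Φ} =
(F_Φ)(d) ⊆ F_Φ` with the Frobenius functor associated to `d` on `F_Φ` [which implies, in particular,
that `C(d)`, equipped with the natural functor `C(d) → F_{d·Φ}`, is a Frobenioid]."

The named statements `PreFrobenioid.UnitLinearFrobeniusExists d` / `CdIsFrobenioid d`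
(`CharacteristicSplitting.lean`, abc-iut-L1-t2) type the case `Λ = ℤ` (`d ∈ ℕ_{≥1}`,
"multiplication by `d`" = `powEnd Φ d`) and record the cases `Λ = ℚ, ℝ` as TODO(general form); they are
DISCHARGED (`unitLinearFrobeniusExists` p411338, `cdIsFrobenioid` p414682).  The proof files
(`UnitLinearFrobenius.lean`, `CdTransport*.lean`, `CdIsFrobenioid.lean`, abc-iut-L6-t9 lineage) are
written for an ARBITRARY endomorphism `δ : Φ → Φ` injective on every `Φ(A)`.  This PROOF-ONLY file
closes the TODO for `Λ = ℝ`: for a monoid `Φ` on `D` supported by `ℝ` (`hS`, Def. 2.4 (ii)(c)) and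
`d ∈ ℝ_{>0}`, "multiplication by `d`" is `realPowEnd Φ hS d` (`SupportsRealActionFunctor.lean`,
abc-iut-L1-d2), injective on every `Φ(A)` (`Supports.realPow_injective`), so the unit-linear Frobenius
functor `Ψ : C ⥲ C(d)` exists with (a), (b), and `C(d) → F_{d·Φ}` is a Frobenioid.  (The case
`Λ = ℚ` needs the `ℚ_{>0}`-action endomorphism of a perfect `Φ`, not yet packaged as `Φ ⟶ Φ`; for
`d ∈ ℕ_{≥1} ⊆ ℝ_{>0}` the real and integral functors agree, `realPowEnd_pnat`.)  No new definitions.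
-/

noncomputable section

namespace Literature.AlgebraicGeometry.Frobenioids

open CategoryTheory Opposite

universe w v v' u u'

namespace PreFrobenioid

variable {D : Type u} [Category.{v} D] {Φ : Dᵒᵖ ⥤ CommMonCat.{w}}
  {C : Type u'} [Category.{v'} C] {F : C ⥤ ElemFrobenioid Φ}

/-- "Multiplication by `d ∈ ℝ_{>0}`" is injective on every `Φ(A)` of a monoid supported by `ℝ`
(`Λ = ℝ` supports `Φ`, Def. 2.4 (ii)(c)). [cite: MochizukiFrdI2008, Def. 2.4(ii) p.48] -/
theorem realPowEnd_app_injective (hS : ∀ X : Dᵒᵖ, Supports (Φ.obj X) .R) {d : NNReal} (hd : d ≠ 0)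
    (A : Dᵒᵖ) : Function.Injective ((realPowEnd Φ hS d).app A).hom :=
  (hS A).realPow_injective hd

namespace CharacteristicSplitting

variable (hF : IsFrobenioid F) (τ : CharacteristicSplitting F) (hmt : IsOfType (IsMetricallyTrivial F))
  (haa : IsOfType (IsAutAmple F)) (hnorm : IsOfType (IsFrobeniusNormalized F))
  (hS : ∀ X : Dᵒᵖ, Supports (Φ.obj X) .R) {d : NNReal} (hd : d ≠ 0)

include hF τ hmt haa hnorm hS hd

/-- **Prop. 2.5 (iii) for `Λ = ℝ`, `d ∈ ℝ_{>0}`**: the unit-linear Frobenius functor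
`Ψ : C → C(d)` (`unitLinearFrobeniusData` at `δ :=` multiplication by `d`) is an equivalence of
categories. [cite: MochizukiFrdI2008, Prop. 2.5(iii) p.49] -/
theorem unitLinearFrobeniusData_isEquivalence_realPow :
    (unitLinearFrobeniusData hF τ hmt haa (realPowEnd Φ hS d) hnorm).functor.IsEquivalence :=
  unitLinearFrobeniusData_isEquivalence hF τ hmt haa (realPowEnd Φ hS d) hnorm
    (realPowEnd_app_injective hS hd)

/-- **Prop. 2.5 (iii), bracket, for `Λ = ℝ`**: `C(d)`, equipped with `C(d) → F_{d·Φ}`, is a Frobenioid.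
[cite: MochizukiFrdI2008, Prop. 2.5(iii) p.49] -/
theorem isFrobenioid_cd_realPow : IsFrobenioid (cdToElem F (realPowEnd Φ hS d)) :=
  isFrobenioid_cd hF τ hmt haa (realPowEnd Φ hS d) hnorm (realPowEnd_app_injective hS hd)

end CharacteristicSplitting

/-- **Prop. 2.5 (iii) in the printed generality `Λ = ℝ`** (`Λ` supports `Φ`, `d ∈ Λ_{>0}`): for every
characteristic splitting `τ` on a Frobenioid `C → F_Φ` of Frobenius-normalized, metrically trivial and
`Aut`-ample type there exists an equivalence `Ψ : C ⥲ C(d)` which (a) acts as the identity on objects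
and isometries and (b) is `1`-compatible — with identity components — relative to `C → F_Φ`,
`C(d) → F_{d·Φ} ⊆ F_Φ`, with the Frobenius functor "multiplication by `d`" on `F_Φ`; and `C(d) → F_{d·Φ}`
is a Frobenioid.  (Same shape as the landed `UnitLinearFrobeniusExists d ∧ CdIsFrobenioid d` for
`d ∈ ℕ_{≥1}`, with `powEnd Φ d` replaced by `realPowEnd Φ hS d`.) [cite: MochizukiFrdI2008, Prop. 2.5(iii) p.49] -/
theorem unitLinearFrobeniusExists_realPow (hS : ∀ X : Dᵒᵖ, Supports (Φ.obj X) .R) {d : NNReal}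
    (hd : d ≠ 0) (τ : CharacteristicSplitting F) (hF : IsFrobenioid F)
    (hnorm : IsOfType (IsFrobeniusNormalized F)) (hmt : IsOfType (IsMetricallyTrivial F))
    (haa : IsOfType (IsAutAmple F)) :
    (∃ U : UnitLinearFrobeniusData F (realPowEnd Φ hS d), U.functor.IsEquivalence ∧
      OneCommutes U.functor (wideSubcategoryInclusion (divIn F (realPowEnd Φ hS d)) ⋙ F) F
        (ElemFrobenioid.mapEnd (realPowEnd Φ hS d))) ∧
      IsFrobenioid (cdToElem F (realPowEnd Φ hS d)) :=
  ⟨⟨CharacteristicSplitting.unitLinearFrobeniusData hF τ hmt haa (realPowEnd Φ hS d) hnorm,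
    CharacteristicSplitting.unitLinearFrobeniusData_isEquivalence_realPow hF τ hmt haa hnorm hS hd,
    CharacteristicSplitting.unitLinearFrobeniusData_oneCommutes hF τ hmt haa (realPowEnd Φ hS d) hnorm⟩,
    CharacteristicSplitting.isFrobenioid_cd_realPow hF τ hmt haa hnorm hS hd⟩

/-- Consistency with the case `Λ = ℤ`: for `d ∈ ℕ_{≥1} ⊆ ℝ_{>0}` the real Frobenius endomorphism IS
`powEnd Φ d`, so the two unit-linear Frobenius functors coincide. [cite: MochizukiFrdI2008, Def. 2.4(iii) p.48] -/
theorem unitLinearFrobeniusData_realPow_pnat (hS : ∀ X : Dᵒᵖ, Supports (Φ.obj X) .R) (d : ℕ+)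
    (τ : CharacteristicSplitting F) (hF : IsFrobenioid F)
    (hnorm : IsOfType (IsFrobeniusNormalized F)) (hmt : IsOfType (IsMetricallyTrivial F))
    (haa : IsOfType (IsAutAmple F)) :
    HEq (CharacteristicSplitting.unitLinearFrobeniusData hF τ hmt haa (realPowEnd Φ hS ((d : ℕ) : NNReal)) hnorm)
      (CharacteristicSplitting.unitLinearFrobeniusData hF τ hmt haa (powEnd Φ d) hnorm) := by
  rw [realPowEnd_pnat]

end PreFrobenioid

end Literature.AlgebraicGeometry.Frobenioids

end
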